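import Literature.AlgebraicGeometry.Resolution.TowerOverCurve
import Literature.AlgebraicGeometry.Resolution.ProjectiveModelsCentresLocal
import Literature.AlgebraicGeometry.Resolution.QuadraticTransforms
import Literature.AlgebraicGeometry.Resolution.BlowupChartQuasiRegular
import HarnessLib

/-!
# Points over a bad curve after principalization are first quadratic transforms

Topic: `Literature/AlgebraicGeometry/Resolution`. Let `A`, `A'` be projective models of `K/k`,
`ρ : A' → A` a morphism of models, `U ⊆ A` open, `σ : S' → U` with `j' : S' → A'` a local
isomorphism at `s'` and `j' ≫ ρ = σ ≫ (U ⊆ A)`. If the local ring of `S'` at `s'` has a CHART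
PRESENTATION along `σ` (`ChartPresentation`, `TowerOverCurve.lean`: it is a localization of a
chart `𝒪_{U,σ s'}[𝔪/c_j]` of the blowing up of the closed point of `Spec 𝒪_{U,σ s'}` at a prime
over `𝔪`), then inside `K` the local ring `𝒪_{A',j' s'}` is a **quadratic transform**
(`IsQuadraticTransform`, Cutkosky §2.1, `QuadraticTransforms.lean`) of `𝒪_{A,σ s'}`
(`isQuadraticTransform_stalkSubring_of_chartPresentation`). Combined with
`IsRegularCentreBlowupSeq.chartPresentation_of_isLocallyPrincipalAt` this is Zariski's
dictionary used in Piltant's proof of Lemma 5.6: after principalizing the ideal of the curve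
`cl{x}` by a Cossart–Piltant sequence, the local rings of the new model at the points over `x`
are first quadratic transforms of `𝒪_{A,x}`. The heart is ring-theoretic
(`isQuadraticTransform_of_chart`): a local ring `(R[𝔪/c_j])_𝔴 ≅ 𝒪_{N,y}` read in `K` contains
`R[𝔪_R/x₀]`, `x₀ = c_j`, consists of fractions of it with unit denominators, and dominates `R`.
All PROVED.

## References

* S. D. Cutkosky, *Introduction to Algebraic Geometry* / Abhyankar 1956, §2.1 (quadratic
  transforms). [Cutkosky2014]
* O. Piltant, RACSAM 107 (2013), proof of Lemma 5.6. [Piltant2013]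
* The Stacks Project, Tag 0804. [StacksProject]
-/

noncomputable section

open CategoryTheory AlgebraicGeometry IsLocalRing

namespace Literature.AlgebraicGeometry.Resolution

universe u

namespace ProjModel

variable {k K : Type u} [Field k] [Field K] [Algebra k K]

/-! ## The ring-theoretic core -/

section Core

/-- The base ring read in `K`: `B ≅ 𝒪_{M,x} → K`. [folklore] -/
def baseToK {M : ProjModel k K} {x : M.X} {B : Type u} [CommRing B]
    (ε : B ≃+* M.X.presheaf.stalk x) : B →+* K :=
  (M.stalkToK x).comp ε.toRingHom

/-- Unfolding. [folklore] -/
theorem baseToK_apply {M : ProjModel k K} {x : M.X} {B : Type u} [CommRing B]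
    (ε : B ≃+* M.X.presheaf.stalk x) (b : B) : baseToK ε b = M.stalkToK x (ε b) := rfl

/-- `B → K` is injective. [folklore] -/
theorem baseToK_injective {M : ProjModel k K} {x : M.X} {B : Type u} [CommRing B]
    (ε : B ≃+* M.X.presheaf.stalk x) : Function.Injective (baseToK ε) :=
  (M.stalkToK_injective x).comp ε.injective

/-- `B → K` lands in `stalkSubring M x`. [folklore] -/
theorem baseToK_mem {M : ProjModel k K} {x : M.X} {B : Type u} [CommRing B]
    (ε : B ≃+* M.X.presheaf.stalk x) (b : B) : baseToK ε b ∈ M.stalkSubring x :=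
  M.stalkToK_mem x _

/-- `B ≅ stalkSubring M x` through `ε` and `stalkEquiv`. [folklore] -/
def baseEquiv {M : ProjModel k K} {x : M.X} {B : Type u} [CommRing B]
    (ε : B ≃+* M.X.presheaf.stalk x) : B ≃+* M.stalkSubring x :=
  ε.trans (M.stalkEquiv x)

/-- Unfolding. [folklore] -/
@[simp] theorem coe_baseEquiv {M : ProjModel k K} {x : M.X} {B : Type u} [CommRing B]
    (ε : B ≃+* M.X.presheaf.stalk x) (b : B) :
    ((baseEquiv ε b : M.stalkSubring x) : K) = baseToK ε b := rfl

/-- `baseEquiv` matches the maximal ideals. [folklore] -/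
theorem mem_maximalIdeal_iff_baseEquiv {M : ProjModel k K} {x : M.X} {B : Type u} [CommRing B]
    [IsLocalRing B] (ε : B ≃+* M.X.presheaf.stalk x) (b : B) :
    b ∈ maximalIdeal B ↔ baseEquiv ε b ∈ maximalIdeal (M.stalkSubring x) := by
  rw [mem_maximalIdeal, mem_maximalIdeal, mem_nonunits_iff, mem_nonunits_iff, MulEquiv.isUnit_map]

/-- The chart ring read in `K`: `B_j → T ≅ 𝒪_{N,y} → K`. [folklore] -/
def chartToK {N : ProjModel k K} (y : N.X) {B : Type u} [CommRing B] (c : Fin 2 → B) (j : Fin 2)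
    {T : Type u} [CommRing T] [Algebra (chartRing c j) T] (τ : T ≃+* N.X.presheaf.stalk y) :
    chartRing c j →+* K :=
  ((N.stalkToK y).comp τ.toRingHom).comp (algebraMap (chartRing c j) T)

/-- Unfolding. [folklore] -/
theorem chartToK_apply {N : ProjModel k K} (y : N.X) {B : Type u} [CommRing B] (c : Fin 2 → B)
    (j : Fin 2) {T : Type u} [CommRing T] [Algebra (chartRing c j) T]
    (τ : T ≃+* N.X.presheaf.stalk y) (z : chartRing c j) :
    chartToK y c j τ z = N.stalkToK y (τ ((algebraMap (chartRing c j) T : _ →+* T) z)) := rfl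

variable {M N : ProjModel k K} {x : M.X} {y : N.X}
  {B : Type u} [CommRing B] [IsLocalRing B] (ε : B ≃+* M.X.presheaf.stalk x)
  (c : Fin 2 → B) (j : Fin 2)
  (𝔴 : PrimeSpectrum (chartRing c j)) {T : Type u} [CommRing T] [Algebra (chartRing c j) T]
  (τ : T ≃+* N.X.presheaf.stalk y)

/-- **The ring-theoretic core**: if `T ≅ 𝒪_{N,y}` is the localization of the chart ring
`B_j = B[𝔪_B/c_j]` (`B ≅ 𝒪_{M,x}`, `𝔪_B = (c₀, c₁)`, `c_j ≠ 0`) at a prime, compatibly with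
`𝒪_{M,x} → K` and `𝒪_{N,y} → K`, and `𝒪_{N,y}` dominates `𝒪_{M,x}` in `K`, then `𝒪_{N,y}` is a
quadratic transform of `𝒪_{M,x}`. [cite: Cutkosky2014, §2.1] -/
theorem isQuadraticTransform_of_chart (hc : Ideal.span (Set.range c) = maximalIdeal B)
    (hcj : c j ≠ 0) [IsLocalization.AtPrime T 𝔴.asIdeal]
    (hcomp : ∀ b, chartToK y c j τ (chartBase c j b) = baseToK ε b)
    (hdom : SubringDominates (M.stalkSubring x) (N.stalkSubring y)) :
    IsQuadraticTransform (M.stalkSubring x) (N.stalkSubring y) := by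
  classical
  set R := M.stalkSubring x with hR
  set R₁ := N.stalkSubring y with hR₁
  -- the chart parameter `x₀ = c_j` read in `R`
  let x₀ : R := baseEquiv ε (c j)
  have hx₀ : (x₀ : K) = baseToK ε (c j) := rfl
  have hx₀0 : (x₀ : K) ≠ 0 := by
    rw [hx₀]; exact (map_ne_zero_iff _ (baseToK_injective ε)).mpr hcj
  have hcm : ∀ i, c i ∈ maximalIdeal B := fun i => hc ▸ Ideal.subset_span ⟨i, rfl⟩
  have hx₀m : x₀ ∈ maximalIdeal R := (mem_maximalIdeal_iff_baseEquiv ε (c j)).mp (hcm j)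
  -- the images of the generators `e_i` of the chart ring: `c_i / c_j`
  have hgen : ∀ i, chartToK y c j τ (chartGen c j i) = baseToK ε (c i) / baseToK ε (c j) := by
    intro i
    have h := congrArg (chartToK y c j τ) (reesChartBase_apply_eq_mul_chartGen c j i)
    rw [map_mul] at h
    change chartToK y c j τ (chartBase c j (c i)) =
      chartToK y c j τ (chartBase c j (c j)) * chartToK y c j τ (chartGen c j i) at h
    rw [hcomp, hcomp] at h
    rw [eq_div_iff (hx₀ ▸ hx₀0), mul_comm, ← h]
  -- (1) `R[𝔪/x₀] ≤ R₁`
  have hle : R ≤ R₁ := hdom.1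
  have hdiv : ∀ i, baseToK ε (c i) / baseToK ε (c j) ∈ R₁ := fun i => by
    rw [← hgen, chartToK_apply]; exact N.stalkToK_mem y _
  have hspan : Ideal.span (Set.range fun i => baseEquiv ε (c i)) = maximalIdeal R := by
    have h1 : Ideal.span (Set.range fun i => baseEquiv ε (c i)) =
        (Ideal.span (Set.range c)).map (baseEquiv ε).toRingHom := by
      rw [Ideal.map_span, ← Set.range_comp]; rfl
    rw [h1, hc]
    haveI : IsLocalHom (baseEquiv ε).toRingHom :=
      ⟨fun b hb => (MulEquiv.isUnit_map (baseEquiv ε)).mp hb⟩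
    exact map_maximalIdeal_of_bijective _ (baseEquiv ε).surjective
  have hblow : blowupRing R (x₀ : K) ≤ R₁ := by
    rw [blowupRing_eq_closure_of_span_eq (x₀ : K) _ hspan, Subring.closure_le]
    rintro z (hz | ⟨_, ⟨i, rfl⟩, rfl⟩)
    · exact hle hz
    · exact hdiv i
  -- (2) the chart ring maps into `R[𝔪/x₀]`
  have hchart : ∀ z : chartRing c j, chartToK y c j τ z ∈ blowupRing R (x₀ : K) := by
    intro z
    obtain ⟨m, F, -, hF⟩ := exists_isHomogeneous_eval₂_eq c j z
    rw [← hF]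
    change (chartToK y c j τ).comp (MvPolynomial.eval₂Hom (chartBase c j) (fun i => chartGen c j i)) F ∈ _
    rw [MvPolynomial.comp_eval₂Hom]
    -- coefficients land in `R ≤ R[𝔪/x₀]`, variables go to `c_i/x₀ ∈ R[𝔪/x₀]`
    let S := blowupRing R (x₀ : K)
    have hcoef : ∀ b, (chartToK y c j τ).comp (chartBase c j) b ∈ S := fun b => by
      rw [RingHom.comp_apply, hcomp]; exact le_blowupRing R _ (baseToK_mem ε b)
    have hvar : ∀ i, chartToK y c j τ (chartGen c j i) ∈ S := fun i => by
      rw [hgen, ← hx₀]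
      exact div_mem_blowupRing (x₀ : K) ((mem_maximalIdeal_iff_baseEquiv ε (c i)).mp (hcm i))
    let f : B →+* S := ((chartToK y c j τ).comp (chartBase c j)).codRestrict S hcoef
    let v : Fin 2 → S := fun i => ⟨_, hvar i⟩
    have hf : (chartToK y c j τ).comp (chartBase c j) = S.subtype.comp f := rfl
    have hv : (fun i => chartToK y c j τ (chartGen c j i)) = S.subtype ∘ v := rfl
    rw [hf, hv, MvPolynomial.coe_eval₂Hom, ← MvPolynomial.eval₂_comp_left]
    exact (MvPolynomial.eval₂ f v F).2
  -- (3) every element of `R₁` is a fraction of elements of `R[𝔪/x₀]` with unit denominator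
  have hfrac : ∀ z ∈ R₁, ∃ a ∈ blowupRing R (x₀ : K), ∃ b ∈ blowupRing R (x₀ : K),
      b⁻¹ ∈ R₁ ∧ z = a / b := by
    intro z hz
    obtain ⟨t, rfl⟩ := (N.mem_stalkSubring_iff y).mp hz
    obtain ⟨t, rfl⟩ : ∃ t' : T, τ t' = t := τ.surjective t
    obtain ⟨⟨p, q⟩, hpq⟩ := IsLocalization.surj 𝔴.asIdeal.primeCompl t
    have hu : IsUnit (algebraMap (chartRing c j) T q) := IsLocalization.map_units T q
    obtain ⟨w, hw⟩ := hu
    refine ⟨chartToK y c j τ p, hchart p, chartToK y c j τ q, hchart q, ?_, ?_⟩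
    · refine (N.mem_stalkSubring_iff y).mpr ⟨τ (↑w⁻¹ : T), ?_⟩
      rw [chartToK_apply, ← hw]
      refine (eq_inv_of_mul_eq_one_left ?_)
      rw [← map_mul, ← map_mul, Units.inv_mul, map_one, map_one]
    · have hq0 : chartToK y c j τ q ≠ 0 := by
        rw [chartToK_apply, ← hw]
        exact ((Units.isUnit w).map ((N.stalkToK y).comp τ.toRingHom)).ne_zero
      rw [eq_div_iff hq0, chartToK_apply, chartToK_apply, ← map_mul, ← map_mul, hpq]
  exact ⟨inferInstance, x₀, hx₀m, fun h => hx₀0 (by rw [h]; rfl), inferInstance, hblow, hfrac, hdom⟩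

end Core

/-! ## The local ring over `x` in `K` -/

section Tower

variable {A A' : ProjModel k K} (ρA : A'.Hom A) (U : A.X.Opens) {S' : Scheme.{u}}
  (σ : S' ⟶ U) (j' : S' ⟶ A'.X) (hw : j' ≫ ρA.f = σ ≫ U.ι) (s' : S') [IsIso (j'.stalkMap s')]

include hw

/-- **`𝒪_{A',j' s'} → K` extends `𝒪_{A,σ s'} → K`** along
`𝒪_{A,σ s'} → 𝒪_{U,σ s'} → 𝒪_{S',s'} ≅ 𝒪_{A',j' s'}` (the square `j' ≫ ρ = σ ≫ ι_U` and the
characterization of `stalkToK` by `Spec 𝒪 → M`). [cite: ZariskiSamuel1960, Ch. VI §17] -/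
theorem stalkToK_tower (t : A.X.presheaf.stalk (U.ι (σ s'))) :
    A'.stalkToK (j' s') ((inv (j'.stalkMap s')).hom ((σ.stalkMap s').hom ((U.ι.stalkMap (σ s')).hom t))) =
      A.stalkToK (U.ι (σ s')) t := by
  let u : A.X.presheaf.stalk (U.ι (σ s')) →+* K :=
    (A'.stalkToK (j' s')).comp ((inv (j'.stalkMap s')).hom.comp
      ((σ.stalkMap s').hom.comp (U.ι.stalkMap (σ s')).hom))
  suffices h : u = A.stalkToK (U.ι (σ s')) from RingHom.congr_fun h t
  apply eq_stalkToK_of_specMap_comp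
  have hu : CommRingCat.ofHom u = U.ι.stalkMap (σ s') ≫ σ.stalkMap s' ≫ inv (j'.stalkMap s') ≫
      CommRingCat.ofHom (A'.stalkToK (j' s')) := rfl
  rw [hu, Spec.map_comp, Spec.map_comp, Spec.map_comp, Category.assoc, Category.assoc,
    Category.assoc, Scheme.SpecMap_stalkMap_fromSpecStalk]
  have h1 : Spec.map (σ.stalkMap s') ≫ (U : Scheme.{u}).fromSpecStalk (σ s') ≫ U.ι =
      S'.fromSpecStalk s' ≫ σ ≫ U.ι := by
    rw [← Category.assoc, Scheme.SpecMap_stalkMap_fromSpecStalk, Category.assoc]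
  have h2 : Spec.map (inv (j'.stalkMap s')) ≫ S'.fromSpecStalk s' ≫ j' =
      A'.X.fromSpecStalk (j' s') := by
    rw [← Scheme.SpecMap_stalkMap_fromSpecStalk (f := j') (x := s'), ← Spec.map_comp_assoc,
      IsIso.hom_inv_id, Spec.map_id, Category.id_comp]
  rw [h1, ← hw, reassoc_of% h2]
  have h3 := congrArg (· ≫ ρA.f) (A'.specMap_stalkToK_fromSpecStalk (j' s'))
  simp only [Category.assoc] at h3
  rw [ρA.gen_f] at h3
  exact h3

/-- **After principalizing the ideal of the curve `cl{x}`, the local rings over `x` are first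
quadratic transforms of `𝒪_{A,x}`**: if `𝒪_{S',s'}` has a chart presentation along `σ : S' → U`
(`ChartPresentation`), `j' : S' → A'` is a local isomorphism at `s'` over `ρ : A' → A`
(`j' ≫ ρ = σ ≫ ι_U`), and `𝒪_{A,σ s'}` is regular of dimension two, then inside `K` the local
ring `𝒪_{A',j' s'}` is a quadratic transform of `𝒪_{A,σ s'}`.
[cite: Piltant2013, Lemma 5.6 (proof); Cutkosky2014, §2.1] -/
theorem isQuadraticTransform_stalkSubring_of_chartPresentation (h : ChartPresentation σ s')
    [IsRegularLocalRing (A.X.presheaf.stalk (U.ι (σ s')))]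
    (hx2 : ringKrullDim (A.X.presheaf.stalk (U.ι (σ s'))) = 2) :
    IsQuadraticTransform (A.stalkSubring (U.ι (σ s'))) (A'.stalkSubring (j' s')) := by
  obtain ⟨B, hB, e, c, hc, j, 𝔴, χ, hχ, hloc, -⟩ := h
  haveI := hB
  letI : Algebra (chartRing c j) (S'.presheaf.stalk s') := χ.toAlgebra
  haveI := hloc
  -- `B ≅ 𝒪_{U,σ s'} ≅ 𝒪_{A,σ s'}`
  let ε : B ≃+* A.X.presheaf.stalk (U.ι (σ s')) :=
    (e.symm ≪≫ (asIso (U.ι.stalkMap (σ s'))).symm).commRingCatIsoToRingEquiv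
  have hε : ∀ b, (U.ι.stalkMap (σ s')).hom (ε b) = e.inv b := fun b => by
    change ((asIso (U.ι.stalkMap (σ s'))).inv ≫ (asIso (U.ι.stalkMap (σ s'))).hom) (e.inv b) = _
    rw [Iso.inv_hom_id]; rfl
  -- `𝒪_{S',s'} ≅ 𝒪_{A',j' s'}`
  let τ : S'.presheaf.stalk s' ≃+* A'.X.presheaf.stalk (j' s') :=
    (asIso (j'.stalkMap s')).symm.commRingCatIsoToRingEquiv
  have hτ : ∀ t, τ t = (inv (j'.stalkMap s')).hom t := fun t => rfl
  -- `c_j ≠ 0`: the maximal ideal of a two-dimensional regular local ring is not principal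
  haveI : IsRegularLocalRing B := IsRegularLocalRing.of_ringEquiv ε.symm
  have hB2 : ringKrullDim B = 2 := by rw [← hx2]; exact ringKrullDim_eq_of_ringEquiv ε
  have hcj : c j ≠ 0 := by
    intro h0
    -- then `𝔪_B = (c_i)` for the other index
    obtain ⟨i, hi⟩ : ∃ i : Fin 2, i ≠ j := ⟨j + 1, by fin_cases j <;> decide⟩
    apply maximalIdeal_ne_span_singleton hB2 (c i)
    rw [← hc]
    apply le_antisymm
    · rw [Ideal.span_le]
      rintro _ ⟨l, rfl⟩
      by_cases hl : l = j
      · rw [hl, h0]; exact Ideal.zero_mem _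
      · have : l = i := by
          fin_cases i <;> fin_cases j <;> fin_cases l <;> simp_all
        rw [this]; exact Ideal.subset_span rfl
    · exact Ideal.span_mono (Set.singleton_subset_iff.mpr ⟨i, rfl⟩)
  refine isQuadraticTransform_of_chart ε c j 𝔴 τ hc hcj (fun b => ?_) ?_
  · rw [chartToK_apply, baseToK_apply, RingHom.algebraMap_toAlgebra, hχ b, hτ, ← hε,
      stalkToK_tower ρA U σ j' hw s']
  · have hpt : ρA.f (j' s') = U.ι (σ s') := by
      rw [← Scheme.Hom.comp_apply, hw, Scheme.Hom.comp_apply]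
    rw [← hpt]
    exact stalkSubring_dominates_of_hom ρA (j' s')

end Tower

end ProjModel

end Literature.AlgebraicGeometry.Resolution

end
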